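import Summits.BirchSwinnertonDyer.BirchSwinnertonDyer.Theorems.EdixhovenFibreFiveSevenOptimalManinUnitFiveSevenOfReciprocityLaw
import HarnessLib

/-!
# Route `TeichmullerTwistDescent`: the WHOLE Manin side — PSMU (22638), SCMU57 (22639), CORNER (23883), LOW (23884), WILD (24306),
# TAME (24307), GE11 (23885) — and the rung W-ALL/2.p>=5.r1, GRANTED ONLY {[REC-tower] (or hT₂), P1-bar, modularity}:
# no F″, no Cremona range, no Fontaine cite, no Ihara lemma

Cell `pub/bsd-wall`, seat `bsd-line-edix-p1` g19 (LEAD of line `kato_lever` of crux K★ stmt-BirchSwinnertonDyer-22226, route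
EdixhovenFibreFiveSeven; this file `--supports` PSMU stmt-BirchSwinnertonDyer-22638 of the sibling route TeichmullerTwistDescent as a helper —
same sub-problem, same rung). TOOL theorems only (no definition, no named fact, no `sorry`); nothing is closed; BSD is not proved by any of this.

WHAT. `TeichmullerTwistDescentCellsOfKato` (ttd-p2 g3) derived the seven Manin-side decls of the route and the rung from the bundle
`KatoNeronAndCremonaFacts` (F″ = `kato_neron_isIntegral_twistedSymbolSum_of_additive_five_le`, universal, cite-only) + modularity. The K★ line has
since split F″ into {P1-bar, hT₂ ⟸ [REC-tower], Kato II Prop. 1.2.3 (proved), de Rham (proved at `p ∈ {5, 7}` on the potentially good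
locus: `DeRhamAtFiveSeven.isDeRham_adicCompletion_rat_fiveSeven`; proved for (G)-ordinary curves at every `p`:
`isDeRham_restrictedRationalTateRep_adicCompletion_rat_of_typeGOrd`)}. The two optimal-datum theorems

* ★★★ `OptimalManinUnitFiveSevenOfReciprocityLaw.not_dvd_optimal_c_fiveSeven_of_expStarTower_of_sl2NeronValuesBar` (`p ∈ {5, 7}`, additive
  potentially good, `E[p]` irreducible; sequel file) and
* ★★★ `OptimalManinUnitFiveSevenOfReciprocityLaw.not_dvd_optimal_c_of_typeGOrd_member_of_expStarTower_of_sl2NeronValuesBar` (`p > 7`, additive,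
  `E[p]` irreducible, SOME isogenous curve (G)-ordinary; the `p > 7` lever `not_dvd_c_of_tameTwistL_at` through the per-class socket, de Rham
  moved from the (G)-ordinary member along the isogeny; same sequel file)

cover every cell of the seven decls. By name, GRANTED {modularity, hT₂ / [REC-tower], P1-bar}: `principalSeriesOptimalManinUnit_…` (PSMU),
`supercuspidalOptimalManinUnitFiveSeven_…` (SCMU57), `kummerCornerWildManinUnit_…` (WILD), `kummerCornerTameManinUnit_…` (TAME),
`ordinaryLowValuationOptimalManinUnitGeEleven_…` (GE11); CORNER (23883) and LOW (23884) are served VERBATIM by the sibling route's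
`OptimalManinUnitFiveSevenOfReciprocityLaw.kummerCornerTorsionOptimalManinUnit_…` / `…supersingularTorsionOptimalManinUnitFive_…` (the two routes'
copies of these decls have identical bodies), and so is the RUNG: `OptimalManinUnitFiveSevenOfReciprocityLaw.wAllExclAdditiveFiveLeRankOne_of_akr_of_reciprocityLaw_of_sl2NeronValuesBar`
(W-ALL/2.p>=5.r1 ⟸ [REC-tower], P1-bar, 21400, 20133, 20134, 20137, 22230 — `KatoNeronAndCremonaFacts` (23789) NOT a hypothesis) has the
same statement for this route's binders. ★★ `maninSide_of_reciprocityLaw_of_sl2NeronValuesBar` — all seven decls at once from {[REC-tower],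
P1-bar, `PublishedInputsAdditiveKoly`} (compare `TeichmullerTwistDescent.maninSide_of_pubBundles`). CONDITIONAL; items stay OPEN; BSD / W-ALL
not proved by this.

References: [Kato2004Asterisque] Thm. 6.6 (1), (8.1.3), Thm. 9.7; [Kato1993LNM1553] Ch. II Thm. 1.4.1 (4), Prop. 1.2.3; [KostersPannekoek2017]
Thm. 1, Cor. 2; [Stevens1989] Lemma (5.2); [EdixhovenManin1991] Thm. 3, §4; [DokchitserDokchitser2015LocalInvariants] Thm. 3.2.
-/

set_option autoImplicit false
-- the Theorems namespace of a single-conjunct summit repeats the summit name by design (D-0017)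
set_option linter.dupNamespace false

noncomputable section

open scoped Classical MatrixGroups NumberField

open WeierstrassCurve NumberField IsDedekindDomain Field ValuativeRel
  Literature.NumberTheory.EllipticCurves Literature.NumberTheory.EllipticCurves.ModularForms
  Literature.NumberTheory.EllipticCurves.Rank1Residual Literature.NumberTheory.EllipticCurves.Kato2004
  Literature.NumberTheory.DiophantineGeometry Rat.HeightOneSpectrum
  Literature.NumberTheory.PAdicHodge Literature.NumberTheory.GaloisRepresentations
  Summit.BirchSwinnertonDyer.Rank1Residual Summit.BirchSwinnertonDyer.Rank1Residual.Additive
  Summit.BirchSwinnertonDyer.BirchSwinnertonDyer.Theorems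
  Summit.BirchSwinnertonDyer.BirchSwinnertonDyer.Theorems.KatoAssemblySocketAt
  Summit.BirchSwinnertonDyer.BirchSwinnertonDyer.Theorems.ManinFrameResidueProperRTameTwistAt
  Summit.BirchSwinnertonDyer.BirchSwinnertonDyer.Theorems.OptimalManinUnitFiveSevenOfReciprocityLaw
  Summit.BirchSwinnertonDyer.BirchSwinnertonDyer.Theses.TeichmullerTwistDescent
  CongruenceSubgroup Complex

namespace Summit.BirchSwinnertonDyer.BirchSwinnertonDyer.Theorems.TeichmullerTwistDescentManinSideOfReciprocityLaw

variable {p : ℕ} [hp : Fact p.Prime]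

/-! ### §1 The seven Manin-side decls of route TeichmullerTwistDescent by name -/

/-- **PSMU `PrincipalSeriesOptimalManinUnit` (stmt-BirchSwinnertonDyer-22638) GRANTED ONLY modularity, hT₂ and P1-bar**: at `p ∈ {5, 7}` by
`not_dvd_optimal_c_fiveSeven_of_expStarTower_of_sl2NeronValuesBar` (no `Iₙ*` at `W` read off the potentially good member,
`TeichmullerTwistDescent.forall_ne_Istar_of_member`), at `p > 7` by `not_dvd_optimal_c_of_typeGOrd_member_of_expStarTower_of_sl2NeronValuesBar`. CONDITIONAL; the item stays OPEN; BSD is not proved by this.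
[cite: Kato2004Asterisque, (8.1.3) (p. 180), Thm. 9.7 (p. 189)] [cite: Stevens1989, Thm. (5.1)] -/
theorem principalSeriesOptimalManinUnit_of_expStarTower_of_sl2NeronValuesBar (hnf : exists_isNewformOf)
    (hT₂ : exists_smul_range_expStarCoord_tower_iff_trace_log) (hP1 : exists_member_sl2ZetaElement_neron_values_bar) :
    PrincipalSeriesOptimalManinUnit := by
  intro W _ _ p _ N _ D hp5 hadd hirr hG hI hopt
  by_cases hp7 : 7 < p
  · exact not_dvd_optimal_c_of_typeGOrd_member_of_expStarTower_of_sl2NeronValuesBar hT₂ hP1 hnf W D hp7 hadd hirr hG hopt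
  · have hp57 : p = 5 ∨ p = 7 := by
      have hpr : p.Prime := Fact.out
      interval_cases p
      · exact Or.inl rfl
      · exact absurd hpr (by norm_num)
      · exact Or.inr rfl
    have hK := (TeichmullerTwistDescent.forall_ne_Istar_iff_placeOf W p).2
      (TeichmullerTwistDescent.forall_ne_Istar_of_member W p (by omega) hI)
    exact not_dvd_optimal_c_fiveSeven_of_expStarTower_of_sl2NeronValuesBar hT₂ hP1 hnf W D hp57 hadd hirr hK hopt

/-- **SCMU57 `SupercuspidalOptimalManinUnitFiveSeven` (stmt-BirchSwinnertonDyer-22639) GRANTED ONLY modularity, hT₂ and P1-bar** — the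
supercuspidality binder is not used. CONDITIONAL; the item stays OPEN; BSD is not proved by this.
[cite: Kato2004Asterisque, (8.1.3) (p. 180), Thm. 9.7 (p. 189)] [cite: EdixhovenManin1991, Thm. 3] -/
theorem supercuspidalOptimalManinUnitFiveSeven_of_expStarTower_of_sl2NeronValuesBar (hnf : exists_isNewformOf)
    (hT₂ : exists_smul_range_expStarCoord_tower_iff_trace_log) (hP1 : exists_member_sl2ZetaElement_neron_values_bar) :
    SupercuspidalOptimalManinUnitFiveSeven := by
  intro W _ _ p _ N _ D hp57 hadd hirr _ hI hopt
  have hK := (TeichmullerTwistDescent.forall_ne_Istar_iff_placeOf W p).2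
    (TeichmullerTwistDescent.forall_ne_Istar_of_member W p (by omega) hI)
  exact not_dvd_optimal_c_fiveSeven_of_expStarTower_of_sl2NeronValuesBar hT₂ hP1 hnf W D hp57 hadd hirr hK hopt

/-- **WILD `KummerCornerWildManinUnit` (stmt-BirchSwinnertonDyer-24306) GRANTED ONLY modularity, hT₂ and P1-bar** — the (G)-ordinary,
torsion and wildness binders are not used. CONDITIONAL; the item stays OPEN.
[cite: Kato2004Asterisque, (8.1.3) (p. 180), Thm. 9.7 (p. 189)] [cite: KostersPannekoek2017, Cor. 2] -/
theorem kummerCornerWildManinUnit_of_expStarTower_of_sl2NeronValuesBar (hnf : exists_isNewformOf)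
    (hT₂ : exists_smul_range_expStarCoord_tower_iff_trace_log) (hP1 : exists_member_sl2ZetaElement_neron_values_bar) :
    KummerCornerWildManinUnit := by
  intro W _ _ p _ _ D hcell hadd hirr _ _ _ hopt
  have hp57 : p = 5 ∨ p = 7 := by rcases hcell with ⟨h, -⟩ | ⟨h, -⟩ <;> simp [h]
  have h4 : padicValInt p W.minimalDiscriminantInt ≤ 4 := by rcases hcell with ⟨-, h⟩ | ⟨-, h⟩ <;> omega
  exact not_dvd_optimal_c_fiveSeven_of_expStarTower_of_sl2NeronValuesBar hT₂ hP1 hnf W D hp57 hadd hirr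
    (OptimalManinUnitFiveSevenOfReciprocityLaw.forall_ne_Istar_of_padicValInt_le_four W (by omega) hadd h4) hopt

/-- **TAME `KummerCornerTameManinUnit` (stmt-BirchSwinnertonDyer-24307) GRANTED ONLY modularity, hT₂ and P1-bar** — the (G)-ordinary,
torsion and tameness binders are not used. CONDITIONAL; the item stays OPEN.
[cite: Kato2004Asterisque, (8.1.3) (p. 180), Thm. 9.7 (p. 189)] [cite: KostersPannekoek2017, Cor. 2] -/
theorem kummerCornerTameManinUnit_of_expStarTower_of_sl2NeronValuesBar (hnf : exists_isNewformOf)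
    (hT₂ : exists_smul_range_expStarCoord_tower_iff_trace_log) (hP1 : exists_member_sl2ZetaElement_neron_values_bar) :
    KummerCornerTameManinUnit := by
  intro W _ _ p _ _ D hcell hadd hirr _ _ _ hopt
  have hp57 : p = 5 ∨ p = 7 := by rcases hcell with ⟨h, -⟩ | ⟨h, -⟩ <;> simp [h]
  have h4 : padicValInt p W.minimalDiscriminantInt ≤ 4 := by rcases hcell with ⟨-, h⟩ | ⟨-, h⟩ <;> omega
  exact not_dvd_optimal_c_fiveSeven_of_expStarTower_of_sl2NeronValuesBar hT₂ hP1 hnf W D hp57 hadd hirr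
    (OptimalManinUnitFiveSevenOfReciprocityLaw.forall_ne_Istar_of_padicValInt_le_four W (by omega) hadd h4) hopt

/-- **GE11 `OrdinaryLowValuationOptimalManinUnitGeEleven` (stmt-BirchSwinnertonDyer-23885) GRANTED ONLY modularity, hT₂ and P1-bar** —
`not_dvd_optimal_c_of_typeGOrd_member_of_expStarTower_of_sl2NeronValuesBar` at the curve itself ((G)-ordinary); the `ord_p Δ_min ≤ 4` binder is not used. CONDITIONAL; the item stays OPEN.
[cite: Kato2004Asterisque, (8.1.3) (p. 180), Thm. 9.7 (p. 189)] [cite: EdixhovenManin1991, Thm. 3] -/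
theorem ordinaryLowValuationOptimalManinUnitGeEleven_of_expStarTower_of_sl2NeronValuesBar (hnf : exists_isNewformOf)
    (hT₂ : exists_smul_range_expStarCoord_tower_iff_trace_log) (hP1 : exists_member_sl2ZetaElement_neron_values_bar) :
    OrdinaryLowValuationOptimalManinUnitGeEleven := by
  intro W _ _ p _ _ D hp11 hadd hirr hG _ hopt
  exact not_dvd_optimal_c_of_typeGOrd_member_of_expStarTower_of_sl2NeronValuesBar hT₂ hP1 hnf W D (by omega) hadd hirr
    ⟨W, ‹_›, ‹_›, isIsogenous_self W, hG⟩ hopt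

/-! ### §2 The Manin side -/

/-- ★★ **All SEVEN Manin-side decls of route TeichmullerTwistDescent — PSMU, SCMU57, CORNER, LOW, WILD, TAME, GE11 — GRANTED ONLY Kato's
explicit reciprocity law [REC-tower], P1-bar and the published-input bundle `PublishedInputsAdditiveKoly` (for modularity).**
`KatoNeronAndCremonaFacts` is NOT a hypothesis (compare `TeichmullerTwistDescent.maninSide_of_pubBundles`). CONDITIONAL; nothing closed.
[cite: Kato1993LNM1553, Ch. II Thm. 1.4.1 (4)] [cite: Kato2004Asterisque, Thm. 6.6 (1) (p. 163), (8.1.3) (p. 180), Thm. 9.7 (p. 189)] -/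
theorem maninSide_of_reciprocityLaw_of_sl2NeronValuesBar
    (hrec : tatePairingPoint_eq_trace_expStar_log_tower) (hP1 : exists_member_sl2ZetaElement_neron_values_bar)
    (hP : PublishedInputsAdditiveKoly) :
    PrincipalSeriesOptimalManinUnit ∧ SupercuspidalOptimalManinUnitFiveSeven ∧
      KummerCornerTorsionOptimalManinUnit ∧ SupersingularTorsionOptimalManinUnitFive ∧
      KummerCornerWildManinUnit ∧ KummerCornerTameManinUnit ∧ OrdinaryLowValuationOptimalManinUnitGeEleven := by
  have hnf : exists_isNewformOf := hP.2.2.2.2.2.1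
  have hT₂ : exists_smul_range_expStarCoord_tower_iff_trace_log :=
    exists_smul_range_expStarCoord_tower_iff_trace_log_of_reciprocityLaw hrec
  exact ⟨principalSeriesOptimalManinUnit_of_expStarTower_of_sl2NeronValuesBar hnf hT₂ hP1,
    supercuspidalOptimalManinUnitFiveSeven_of_expStarTower_of_sl2NeronValuesBar hnf hT₂ hP1,
    -- CORNER / LOW: the sibling route's closers serve verbatim (the two routes' copies of the decls have identical bodies)
    OptimalManinUnitFiveSevenOfReciprocityLaw.kummerCornerTorsionOptimalManinUnit_of_expStarTower_of_sl2NeronValuesBar hnf hT₂ hP1,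
    OptimalManinUnitFiveSevenOfReciprocityLaw.supersingularTorsionOptimalManinUnitFive_of_expStarTower_of_sl2NeronValuesBar hnf hT₂ hP1,
    kummerCornerWildManinUnit_of_expStarTower_of_sl2NeronValuesBar hnf hT₂ hP1,
    kummerCornerTameManinUnit_of_expStarTower_of_sl2NeronValuesBar hnf hT₂ hP1,
    ordinaryLowValuationOptimalManinUnitGeEleven_of_expStarTower_of_sl2NeronValuesBar hnf hT₂ hP1⟩

end Summit.BirchSwinnertonDyer.BirchSwinnertonDyer.Theorems.TeichmullerTwistDescentManinSideOfReciprocityLaw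

end
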